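import Summits.QuantumFields.BalabanUV.Beta.EriceFlowEnclosureB12AsPrintedHistoryContagionShiftFlowZeroTangentPin

/-!
# Beta / EriceFlowEnclosureB12AsPrintedHistoryContagionShiftFlowZeroTangentSecond — ASYMPTOTIC FREEDOM IS CONTAGIOUS, part 78: THE DERIVED LINEAR MEMORY EQUATION (THE
# SECOND VARIATION OF THE FLOW WITH MEMORY).  THE C² SHAPE, DEF-FREE, in binders (explicit hypotheses of OUR theorems, NOT a node U2 interface; whether Bałaban's β_k — analytic
# in the couplings by construction, [I] §1 — pass a Hessian to their scale-shift limit is NOT asserted): on top of part 68's gradient `G` (`hG`, `hGB`), a HESSIAN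
# `H : (ℕ → ℝ) → ℕ → ℕ → ℝ` with the SEPARABLE MEMORY PROFILE **`|H u j i| ≤ C_H θ^j θ^i`** on the box (`hH`; a functional whose mixed second derivative in the couplings of
# ages j and i decays like `θ^{max(i,j)}` carries it with θ ↦ √θ) and a UNIFORM SECOND-ORDER REMAINDER **`∀ ε > 0 ∃ ρ > 0: sup|u′ − u| ≤ ρ ⟹ |G u′ j − G u j − Σ_i H u j i (u′_i
# − u_i)| ≤ εθ^j·Σ_i θ^i|u′_i − u_i|` for every j** (`hHB`).  (§136) The shape implies part 71's continuity letter `hGc` for the gradient (`gradient_continuity_of_hessian`).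
# (§137) At a pin `e ∈ ]0, e′]` with tangent flow W, differentiating part 68's tangent equation `W_k = 1 − Σ_{p<k}Σ_j c_{p,j} v_{p+1+j} W_{p+1+j}` in the CHART `c = 1∕e²`
# (part 77's dictionary `∂_c h_q = −(h_q³∕2)W_q =: U_q`, `|U_q| ≤ w_q`) produces the DERIVED DATA **`c′_{p,j} = Σ_i H(h_{p+1+·}) j i · U_{p+1+i}`**,
# **`v′_q = −(3∕4)h_q⁵W_q`** and the DERIVED SOURCE **`σ_k = −Σ_{p<k}Σ_j (c′_{p,j}v_{p+1+j} + c_{p,j}v′_{p+1+j})·W_{p+1+j}`**: every piece is WEIGHTED BY ASYMPTOTIC FREEDOM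
# (`|c′_{p,j}| ≤ C_Hθ^j w_{p+1}∕(1−θ)`, `|v′_q| ≤ 6e′²w_q`, `|summand_{p,j}| ≤ Kθ^j w_{p+1+j}`, `K = 8C_He′³∕(1−θ) + 12C_me′²`), so **`|σ_k| ≤ KS∕(1−θ)` UNIFORMLY IN THE SCALE**
# (`S = 8e′³ + 16e′∕β*`) and `σ_k → σ_∞` at the AF rate.  (§138) Hence part 66's engine runs AGAIN with the same kernel: the DERIVED LINEAR MEMORY EQUATION
# **`V_k = σ_k − Σ_{p<k}Σ_j c_{p,j} v_{p+1+j} V_{p+1+j}`** — the equation the chart-derivative `∂_c W_k` must satisfy — has a bounded solution (`|V| ≤ 2KS∕(1−θ)`), unique, with an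
# ultraviolet limit `V_∞`; parts 79–80 show that V IS the pin-derivative of the tangent flow.  The engine is closed under differentiation
# (β-flow team, prover 1, unit `b2b-balaban-beta-bflow-p1`, gen 43; ROW AP-I·Uc × NODE U2)

HONEST FRAMING (page 1 of everything the β sub-cell writes): discharging `BetaPertH` makes Bałaban's UV stability UNCONDITIONAL — a
real constructive-QFT result; it is NOT the continuum limit and NOT the Clay problem.  HONEST DEPENDENCY (cell reorg 2026-08-19,
verbatim): «continuum YM on T⁴ ⇐ BetaPertH ∧ nine spine estimates (0/9 proved); BetaPertH ⇐ (D1) ∧ (D4) ∧ CAP+tail; G-an2-4 gates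
asym, D1 and NE2/3/4.»  THIS MODULE DISCHARGES NOTHING: [folklore] real analysis (geometric rows, parts 66–67's kernel and fixed-point lemmas applied to new data) over node
U2's HYPOTHESIS SHAPES `T4BetaStationary.{SeqBox, MemoryProfile}`, `T4BetaFlowWellPosed.{MemFlow, solution, seqBox_shift}`, `T4CouplingMatching.{sprof}` and parts 66, 67, 68, 77
of this series BY NAME (NOT PRINTED for [I] = T. Bałaban, Commun. Math. Phys. **109** (1987) [Balaban1987RG1]: p. 298 says only that β_j depends on the preceding couplings;
(0.20) p. 256; Theorem 2 (0.31) p. 259 STATED WITHOUT PROOF; no derivative of the coupling flow in its datum is printed in [I]).  The C² shape is OUR hypothesis, an explicit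
binder.  Nothing of Bałaban's β is asserted.

WHAT THIS FILE PROVES (0 sorry, 0 def): §136 **`gradient_continuity_of_hessian`**; §137 **`derivedCoeff_summable_abs_le`**, `derivedTerm_abs_le`, `derivedTerm_summable`,
**`derivedSource_abs_le`**, **`derivedSource_limit_exists`**; §138 **`secondTangent_exists`**, `secondTangent_unique`, **`secondTangentLimit_exists`**.  NOT CLAIMED: that V is
the derivative of the tangent flow (parts 79–80); anything about Bałaban's β; `BetaPertH`; the continuum limit of the measures; Clay.
-/

namespace Summit.QuantumFields.BalabanUV.Beta.EriceFlowEnclosureB12AsPrintedHistoryContagionShiftFlowZeroTangentSecond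

open Finset Filter Topology Set
open Literature.MathematicalPhysics.QuantumFieldTheory.Balaban1983to89
open Literature.MathematicalPhysics.QuantumFieldTheory.Balaban1983to89.T4CouplingMatching (sprof sprof_zero)
open Literature.MathematicalPhysics.QuantumFieldTheory.Balaban1983to89.T4BetaStationary (SeqBox MemoryProfile)
open Literature.MathematicalPhysics.QuantumFieldTheory.Balaban1983to89.T4BetaFlowWellPosed (MemFlow solution seqBox_shift)
open Summit.QuantumFields.BalabanUV.Beta.EriceFlowEnclosureB12AsPrintedHistoryContagionShiftFlowZeroTangent (row_summable_abs_le kernel_abs_le kernel_tail_abs_le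
  fixedPoint_exists fixedPoint_unique)
open Summit.QuantumFields.BalabanUV.Beta.EriceFlowEnclosureB12AsPrintedHistoryContagionShiftFlowZeroTangentLimit (profWeight_nonneg profWeight_anti
  sum_profWeight_le sum_Ico_profWeight_le inv_sprof_tendsto_zero exists_limit_of_tail fixedPoint_limit_exists)
open Summit.QuantumFields.BalabanUV.Beta.EriceFlowEnclosureB12AsPrintedHistoryContagionShiftFlowZeroTangentFlow (solution_facts tangent_data smallness_of_hs5)
open Summit.QuantumFields.BalabanUV.Beta.EriceFlowEnclosureB12AsPrintedHistoryContagionShiftFlowZeroTangentPin (chartDeriv_facts jacobianDeriv_abs_le)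

noncomputable section

/-! ## §136 The C² shape implies the uniform continuity of the gradient -/

/-- **A HESSIAN WITH THE MEMORY PROFILE AND A UNIFORM SECOND-ORDER REMAINDER MAKE THE GRADIENT UNIFORMLY CONTINUOUS**: `hH` (`|H u j i| ≤ C_Hθ^jθ^i`) and `hHB` (second-order
remainder `εθ^jΣ_iθ^i|u′_i − u_i|` at sup-distance ρ(ε)) ⟹ part 71's continuity letter `hGc`: `∀ ε > 0 ∃ ρ > 0: sup|u′ − u| ≤ ρ ⟹ |G u′ j − G u j| ≤ εθ^j` for every j
(`|G u′ j − G u j| ≤ (C_H + 1)θ^j·Σ_iθ^i|u′_i − u_i| ≤ (C_H + 1)θ^j ρ∕(1−θ)` for `ρ ≤ ρ(1)`). [folklore] -/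
theorem gradient_continuity_of_hessian {G : (ℕ → ℝ) → ℕ → ℝ} {H : (ℕ → ℝ) → ℕ → ℕ → ℝ} {CH θ γ : ℝ} (hCH : 0 ≤ CH) (hθ0 : 0 ≤ θ) (hθ1 : θ < 1)
    (hH : ∀ u : ℕ → ℝ, SeqBox γ u → ∀ j i, |H u j i| ≤ CH * θ ^ j * θ ^ i)
    (hHB : ∀ ε > 0, ∃ ρ > 0, ∀ u u' : ℕ → ℝ, SeqBox γ u → SeqBox γ u' → (∀ j, |u' j - u j| ≤ ρ) →
      ∀ j, |G u' j - G u j - ∑' i, H u j i * (u' i - u i)| ≤ ε * θ ^ j * ∑' i, θ ^ i * |u' i - u i|) :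
    ∀ ε > 0, ∃ ρ > 0, ∀ u u' : ℕ → ℝ, SeqBox γ u → SeqBox γ u' → (∀ j, |u' j - u j| ≤ ρ) → ∀ j, |G u' j - G u j| ≤ ε * θ ^ j := by
  intro ε hε
  have h1θ : 0 < 1 - θ := by linarith
  obtain ⟨ρ₁, hρ₁, hrem⟩ := hHB 1 one_pos
  set ρ' : ℝ := ε * (1 - θ) / (CH + 1) with hρ'
  have hρ'0 : 0 < ρ' := by positivity
  refine ⟨min ρ₁ ρ', lt_min hρ₁ hρ'0, fun u u' hu hu' hd j => ?_⟩
  have hd₁ : ∀ i, |u' i - u i| ≤ ρ₁ := fun i => (hd i).trans (min_le_left _ _)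
  have hd₂ : ∀ i, |u' i - u i| ≤ ρ' := fun i => (hd i).trans (min_le_right _ _)
  have hgeom : Summable fun i : ℕ => θ ^ i * ρ' := (summable_geometric_of_lt_one hθ0 hθ1).mul_right _
  have hle : ∀ i, θ ^ i * |u' i - u i| ≤ θ ^ i * ρ' := fun i => mul_le_mul_of_nonneg_left (hd₂ i) (pow_nonneg hθ0 i)
  have hsΔ : Summable fun i => θ ^ i * |u' i - u i| :=
    Summable.of_nonneg_of_le (fun i => mul_nonneg (pow_nonneg hθ0 i) (abs_nonneg _)) hle hgeom
  have hT : ∑' i, θ ^ i * |u' i - u i| ≤ ρ' / (1 - θ) :=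
    calc ∑' i, θ ^ i * |u' i - u i| ≤ ∑' i : ℕ, θ ^ i * ρ' := hsΔ.tsum_le_tsum hle hgeom
      _ = (∑' i : ℕ, θ ^ i) * ρ' := tsum_mul_right
      _ = ρ' / (1 - θ) := by rw [tsum_geometric_of_lt_one hθ0 hθ1]; ring
  have hT0 : 0 ≤ ∑' i, θ ^ i * |u' i - u i| := tsum_nonneg fun i => mul_nonneg (pow_nonneg hθ0 i) (abs_nonneg _)
  -- the linear part
  have hF : ∀ i, |H u j i * (u' i - u i)| ≤ (CH * θ ^ j) * (θ ^ i * |u' i - u i|) := fun i => by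
    rw [abs_mul]
    calc |H u j i| * |u' i - u i| ≤ CH * θ ^ j * θ ^ i * |u' i - u i| := mul_le_mul_of_nonneg_right (hH u hu j i) (abs_nonneg _)
      _ = (CH * θ ^ j) * (θ ^ i * |u' i - u i|) := by ring
  have hsl : Summable fun i => H u j i * (u' i - u i) :=
    Summable.of_norm_bounded (hsΔ.mul_left (CH * θ ^ j)) fun i => by rw [Real.norm_eq_abs]; exact hF i
  have hlin : |∑' i, H u j i * (u' i - u i)| ≤ CH * θ ^ j * ∑' i, θ ^ i * |u' i - u i| := by
    have hsn : Summable fun i => ‖H u j i * (u' i - u i)‖ := by simpa only [Real.norm_eq_abs] using hsl.abs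
    calc |∑' i, H u j i * (u' i - u i)| ≤ ∑' i, |H u j i * (u' i - u i)| := by
          have h := norm_tsum_le_tsum_norm hsn; simpa only [Real.norm_eq_abs] using h
      _ ≤ ∑' i, (CH * θ ^ j) * (θ ^ i * |u' i - u i|) := hsl.abs.tsum_le_tsum hF (hsΔ.mul_left _)
      _ = CH * θ ^ j * ∑' i, θ ^ i * |u' i - u i| := tsum_mul_left
  have hr := hrem u u' hu hu' hd₁ j
  have hθj : 0 ≤ θ ^ j := pow_nonneg hθ0 j
  calc |G u' j - G u j| ≤ |G u' j - G u j - ∑' i, H u j i * (u' i - u i)| + |∑' i, H u j i * (u' i - u i)| := by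
        have := abs_add_le (G u' j - G u j - ∑' i, H u j i * (u' i - u i)) (∑' i, H u j i * (u' i - u i))
        rwa [sub_add_cancel] at this
    _ ≤ 1 * θ ^ j * ∑' i, θ ^ i * |u' i - u i| + CH * θ ^ j * ∑' i, θ ^ i * |u' i - u i| := add_le_add hr hlin
    _ = (CH + 1) * θ ^ j * ∑' i, θ ^ i * |u' i - u i| := by ring
    _ ≤ (CH + 1) * θ ^ j * (ρ' / (1 - θ)) := mul_le_mul_of_nonneg_left hT (by positivity)
    _ = ε * θ ^ j := by rw [hρ']; field_simp

/-! ## §137 The derived data and the derived source at a pin: everything is weighted by asymptotic freedom -/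

/-- **THE DERIVED COEFFICIENTS.**  Part 14's package at e′, `hG`, the Hessian profile `hH`, `e ∈ ]0, e′]`, W the tangent flow at e, `h = solution B e`.  The chart-derivative of
the coefficient `c_{p,j} = G(h_{p+1+·}) j` is `c′_{p,j} = −Σ_i H(h_{p+1+·}) j i·((h_{p+1+i}³∕2)W_{p+1+i})`; the row is SUMMABLE and
**`|Σ_i H(h_{p+1+·}) j i·((h_{p+1+i}³∕2)W_{p+1+i})| ≤ C_Hθ^j·w_{p+1}∕(1−θ) ≤ (8C_He′³∕(1−θ))·θ^j`** (part 77: `(h_q³∕2)W_q ≤ w_q` antitone; part 66's row lemma).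
[cite: Balaban1987RG1, Thm 2 (0.31) p.259 with (0.20) p.256 and p.298] -/
theorem derivedCoeff_summable_abs_le {B : (ℕ → ℝ) → ℝ} {G : (ℕ → ℝ) → ℕ → ℝ} {H : (ℕ → ℝ) → ℕ → ℕ → ℝ} {Cm CH θ γ bs ta gs e' : ℝ} {t W : ℕ → ℝ}
    (hB : MemoryProfile Cm θ γ B) (hCm : 0 ≤ Cm) (hθ0 : 0 ≤ θ) (hθ1 : θ < 1) (hbs : 0 < bs) (hta : 0 < ta)
    (hts : SeqBox γ t) (htf : MemFlow B gs t) (hprof : ∀ m : ℕ, 1 / ta ^ 2 + bs * (m : ℝ) ≤ 1 / (t m) ^ 2)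
    (hG : ∀ u : ℕ → ℝ, SeqBox γ u → ∀ j, |G u j| ≤ Cm * θ ^ j) (hCH : 0 ≤ CH)
    (hH : ∀ u : ℕ → ℝ, SeqBox γ u → ∀ j i, |H u j i| ≤ CH * θ ^ j * θ ^ i)
    (h2e' : 2 * e' ≤ γ) (hs1 : 4 * Cm * e' ≤ bs * (1 - θ))
    (hs2 : e' ^ 2 * (1 / gs ^ 2 + Cm * γ / (1 - θ) ^ 2 + (2 * Cm / ((1 - θ) * bs)) ^ 2) ≤ 3 / 4)
    (hs4 : 64 * Cm * e' ^ 3 ≤ (1 - θ) ^ 2) (hs5 : Cm * (8 * e' ^ 3 + 16 * e' / bs) ≤ (1 - θ) / 4) {e : ℝ} (he : e ∈ Ioc (0 : ℝ) e')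
    (hW : ∀ k, W k = 1 - ∑ p ∈ range k, ∑' j, G (fun i => solution B e (p + 1 + i)) j * ((solution B e (p + 1 + j)) ^ 3 / 2) * W (p + 1 + j))
    (hWM : ∀ k, |W k| ≤ 2) (p j : ℕ) :
    Summable (fun i => H (fun l => solution B e (p + 1 + l)) j i * ((solution B e (p + 1 + i)) ^ 3 / 2 * W (p + 1 + i))) ∧
      |∑' i, H (fun l => solution B e (p + 1 + l)) j i * ((solution B e (p + 1 + i)) ^ 3 / 2 * W (p + 1 + i))|
        ≤ CH * θ ^ j * (1 / (sprof (2 * e') (bs / 4) (p + 1)) ^ 2 * (1 / sprof (2 * e') (bs / 4) (p + 1))) / (1 - θ) ∧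
      |∑' i, H (fun l => solution B e (p + 1 + l)) j i * ((solution B e (p + 1 + i)) ^ 3 / 2 * W (p + 1 + i))| ≤ 8 * CH * e' ^ 3 / (1 - θ) * θ ^ j := by
  have he' : 0 < e' := he.1.trans_le he.2
  have h1θ : 0 < 1 - θ := by linarith
  obtain ⟨hsb, -⟩ := solution_facts hB hCm hθ0 hθ1 hbs hta hts htf hprof h2e' hs1 hs2 hs4 hs5 he
  have hU := fun q => (chartDeriv_facts hB hCm hθ0 hθ1 hbs hta hts htf hprof hG h2e' hs1 hs2 hs4 hs5 he hW hWM q).2.2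
  have hF : ∀ i, |H (fun l => solution B e (p + 1 + l)) j i * ((solution B e (p + 1 + i)) ^ 3 / 2 * W (p + 1 + i))|
      ≤ (CH * θ ^ j) * θ ^ i * ((1 / (sprof (2 * e') (bs / 4) (p + 1 + i)) ^ 2 * (1 / sprof (2 * e') (bs / 4) (p + 1 + i))) * 1) := fun i => by
    rw [abs_mul, mul_one]
    exact mul_le_mul (hH _ (seqBox_shift hsb (p + 1)) j i) (hU (p + 1 + i)) (abs_nonneg _) (by positivity)
  have hrow := row_summable_abs_le hθ0 hθ1 (fun hab => profWeight_anti hbs he' hab) zero_le_one (by positivity : 0 ≤ CH * θ ^ j) p hF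
  have hb : CH * θ ^ j * (1 / (sprof (2 * e') (bs / 4) (p + 1)) ^ 2 * (1 / sprof (2 * e') (bs / 4) (p + 1)) * 1) / (1 - θ)
      = CH * θ ^ j * (1 / (sprof (2 * e') (bs / 4) (p + 1)) ^ 2 * (1 / sprof (2 * e') (bs / 4) (p + 1))) / (1 - θ) := by rw [mul_one]
  rw [hb] at hrow
  refine ⟨hrow.1, hrow.2, hrow.2.trans ?_⟩
  have hw8 : 1 / (sprof (2 * e') (bs / 4) (p + 1)) ^ 2 * (1 / sprof (2 * e') (bs / 4) (p + 1)) ≤ 8 * e' ^ 3 := by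
    have h := profWeight_anti hbs he' (Nat.zero_le (p + 1))
    rw [sprof_zero (by positivity : (0:ℝ) < 2 * e')] at h
    have e8 : 1 / (1 / (2 * e')) ^ 2 * (1 / (1 / (2 * e'))) = 8 * e' ^ 3 := by field_simp; ring
    rw [e8] at h
    exact h
  rw [div_le_iff₀ h1θ]
  have hθj : 0 ≤ θ ^ j := pow_nonneg hθ0 j
  calc CH * θ ^ j * (1 / (sprof (2 * e') (bs / 4) (p + 1)) ^ 2 * (1 / sprof (2 * e') (bs / 4) (p + 1)))
      ≤ CH * θ ^ j * (8 * e' ^ 3) := mul_le_mul_of_nonneg_left hw8 (by positivity)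
    _ = 8 * CH * e' ^ 3 / (1 - θ) * θ ^ j * (1 - θ) := by field_simp

/-- **THE SUMMAND OF THE DERIVED SOURCE IS BELOW `Kθ^j w_{p+1+j}`**, `K = 8C_He′³∕(1−θ) + 12C_me′²`: `|(c′_{p,j}v_{p+1+j} + c_{p,j}v′_{p+1+j})W_{p+1+j}| ≤ (|c′||v| + |c||v′|)·2`
with `|c′| ≤ (8C_He′³∕(1−θ))θ^j`, `|v| ≤ w∕2`, `|c| ≤ C_mθ^j`, `|v′| ≤ 6e′²w` (part 77). [folklore] -/
theorem derivedTerm_abs_le {B : (ℕ → ℝ) → ℝ} {G : (ℕ → ℝ) → ℕ → ℝ} {H : (ℕ → ℝ) → ℕ → ℕ → ℝ} {Cm CH θ γ bs ta gs e' : ℝ} {t W : ℕ → ℝ}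
    (hB : MemoryProfile Cm θ γ B) (hCm : 0 ≤ Cm) (hθ0 : 0 ≤ θ) (hθ1 : θ < 1) (hbs : 0 < bs) (hta : 0 < ta)
    (hts : SeqBox γ t) (htf : MemFlow B gs t) (hprof : ∀ m : ℕ, 1 / ta ^ 2 + bs * (m : ℝ) ≤ 1 / (t m) ^ 2)
    (hG : ∀ u : ℕ → ℝ, SeqBox γ u → ∀ j, |G u j| ≤ Cm * θ ^ j) (hCH : 0 ≤ CH)
    (hH : ∀ u : ℕ → ℝ, SeqBox γ u → ∀ j i, |H u j i| ≤ CH * θ ^ j * θ ^ i)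
    (h2e' : 2 * e' ≤ γ) (hs1 : 4 * Cm * e' ≤ bs * (1 - θ))
    (hs2 : e' ^ 2 * (1 / gs ^ 2 + Cm * γ / (1 - θ) ^ 2 + (2 * Cm / ((1 - θ) * bs)) ^ 2) ≤ 3 / 4)
    (hs4 : 64 * Cm * e' ^ 3 ≤ (1 - θ) ^ 2) (hs5 : Cm * (8 * e' ^ 3 + 16 * e' / bs) ≤ (1 - θ) / 4) {e : ℝ} (he : e ∈ Ioc (0 : ℝ) e')
    (hW : ∀ k, W k = 1 - ∑ p ∈ range k, ∑' j, G (fun i => solution B e (p + 1 + i)) j * ((solution B e (p + 1 + j)) ^ 3 / 2) * W (p + 1 + j))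
    (hWM : ∀ k, |W k| ≤ 2) (p j : ℕ) :
    |((-∑' i, H (fun l => solution B e (p + 1 + l)) j i * ((solution B e (p + 1 + i)) ^ 3 / 2 * W (p + 1 + i))) * ((solution B e (p + 1 + j)) ^ 3 / 2)
        + G (fun i => solution B e (p + 1 + i)) j * (-(3 / 4 * (solution B e (p + 1 + j)) ^ 5 * W (p + 1 + j)))) * W (p + 1 + j)|
      ≤ (8 * CH * e' ^ 3 / (1 - θ) + 12 * Cm * e' ^ 2) * θ ^ j
          * ((1 / (sprof (2 * e') (bs / 4) (p + 1 + j)) ^ 2 * (1 / sprof (2 * e') (bs / 4) (p + 1 + j))) * 1) := by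
  have he' : 0 < e' := he.1.trans_le he.2
  have h1θ : 0 < 1 - θ := by linarith
  obtain ⟨hsb, -, -, -, -, hcube⟩ := solution_facts hB hCm hθ0 hθ1 hbs hta hts htf hprof h2e' hs1 hs2 hs4 hs5 he
  obtain ⟨hc, hv⟩ := tangent_data (B := B) (e' := e') hG hsb hcube
  have hc' := (derivedCoeff_summable_abs_le hB hCm hθ0 hθ1 hbs hta hts htf hprof hG hCH hH h2e' hs1 hs2 hs4 hs5 he hW hWM p j).2.2
  have hv' := (jacobianDeriv_abs_le hB hCm hθ0 hθ1 hbs hta hts htf hprof hG h2e' hs1 hs2 hs4 hs5 he hW hWM (p + 1 + j)).2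
  set w : ℝ := 1 / (sprof (2 * e') (bs / 4) (p + 1 + j)) ^ 2 * (1 / sprof (2 * e') (bs / 4) (p + 1 + j)) with hw
  have hw0 : 0 ≤ w := profWeight_nonneg hbs he' (p + 1 + j)
  have hθj : 0 ≤ θ ^ j := pow_nonneg hθ0 j
  set cc : ℝ := ∑' i, H (fun l => solution B e (p + 1 + l)) j i * ((solution B e (p + 1 + i)) ^ 3 / 2 * W (p + 1 + i)) with hcc
  set vv : ℝ := (solution B e (p + 1 + j)) ^ 3 / 2 with hvv
  set gg : ℝ := G (fun i => solution B e (p + 1 + i)) j with hgg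
  set vd : ℝ := 3 / 4 * (solution B e (p + 1 + j)) ^ 5 * W (p + 1 + j) with hvd
  have h1 : |(-cc) * vv| ≤ 8 * CH * e' ^ 3 / (1 - θ) * θ ^ j * (w / 2) := by
    rw [abs_mul, abs_neg]; exact mul_le_mul hc' (hv (p + 1 + j)) (abs_nonneg _) (by positivity)
  have h2 : |gg * (-vd)| ≤ Cm * θ ^ j * (6 * e' ^ 2 * w) := by
    rw [abs_mul, abs_neg]; exact mul_le_mul (hc p j) hv' (abs_nonneg _) (by positivity)
  rw [abs_mul]
  calc |(-cc) * vv + gg * (-vd)| * |W (p + 1 + j)| ≤ (8 * CH * e' ^ 3 / (1 - θ) * θ ^ j * (w / 2) + Cm * θ ^ j * (6 * e' ^ 2 * w)) * 2 :=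
        mul_le_mul ((abs_add_le _ _).trans (add_le_add h1 h2)) (hWM _) (abs_nonneg _) (by positivity)
    _ = (8 * CH * e' ^ 3 / (1 - θ) + 12 * Cm * e' ^ 2) * θ ^ j * (w * 1) := by ring

/-- Each row of the derived source is summable. [folklore] -/
theorem derivedTerm_summable {B : (ℕ → ℝ) → ℝ} {G : (ℕ → ℝ) → ℕ → ℝ} {H : (ℕ → ℝ) → ℕ → ℕ → ℝ} {Cm CH θ γ bs ta gs e' : ℝ} {t W : ℕ → ℝ}
    (hB : MemoryProfile Cm θ γ B) (hCm : 0 ≤ Cm) (hθ0 : 0 ≤ θ) (hθ1 : θ < 1) (hbs : 0 < bs) (hta : 0 < ta)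
    (hts : SeqBox γ t) (htf : MemFlow B gs t) (hprof : ∀ m : ℕ, 1 / ta ^ 2 + bs * (m : ℝ) ≤ 1 / (t m) ^ 2)
    (hG : ∀ u : ℕ → ℝ, SeqBox γ u → ∀ j, |G u j| ≤ Cm * θ ^ j) (hCH : 0 ≤ CH)
    (hH : ∀ u : ℕ → ℝ, SeqBox γ u → ∀ j i, |H u j i| ≤ CH * θ ^ j * θ ^ i)
    (h2e' : 2 * e' ≤ γ) (hs1 : 4 * Cm * e' ≤ bs * (1 - θ))
    (hs2 : e' ^ 2 * (1 / gs ^ 2 + Cm * γ / (1 - θ) ^ 2 + (2 * Cm / ((1 - θ) * bs)) ^ 2) ≤ 3 / 4)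
    (hs4 : 64 * Cm * e' ^ 3 ≤ (1 - θ) ^ 2) (hs5 : Cm * (8 * e' ^ 3 + 16 * e' / bs) ≤ (1 - θ) / 4) {e : ℝ} (he : e ∈ Ioc (0 : ℝ) e')
    (hW : ∀ k, W k = 1 - ∑ p ∈ range k, ∑' j, G (fun i => solution B e (p + 1 + i)) j * ((solution B e (p + 1 + j)) ^ 3 / 2) * W (p + 1 + j))
    (hWM : ∀ k, |W k| ≤ 2) (p : ℕ) :
    Summable fun j => ((-∑' i, H (fun l => solution B e (p + 1 + l)) j i * ((solution B e (p + 1 + i)) ^ 3 / 2 * W (p + 1 + i)))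
        * ((solution B e (p + 1 + j)) ^ 3 / 2)
        + G (fun i => solution B e (p + 1 + i)) j * (-(3 / 4 * (solution B e (p + 1 + j)) ^ 5 * W (p + 1 + j)))) * W (p + 1 + j) := by
  have he' : 0 < e' := he.1.trans_le he.2
  have h1θ : 0 < 1 - θ := by linarith
  have hK : 0 ≤ 8 * CH * e' ^ 3 / (1 - θ) + 12 * Cm * e' ^ 2 := by positivity
  exact (row_summable_abs_le hθ0 hθ1 (fun hab => profWeight_anti hbs he' hab) zero_le_one hK p
    (derivedTerm_abs_le hB hCm hθ0 hθ1 hbs hta hts htf hprof hG hCH hH h2e' hs1 hs2 hs4 hs5 he hW hWM p)).1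

/-- **THE DERIVED SOURCE IS BOUNDED UNIFORMLY IN THE SCALE**: with `σ_k = −Σ_{p<k}Σ_j (c′_{p,j}v_{p+1+j} + c_{p,j}v′_{p+1+j})W_{p+1+j}` (spelled out in `hσ`),
**`|σ_k| ≤ K·S∕(1−θ)`** for every k, `K = 8C_He′³∕(1−θ) + 12C_me′²`, `S = 8e′³ + 16e′∕β*` (part 66's kernel lemma on `derivedTerm_abs_le`).
[cite: Balaban1987RG1, Thm 2 (0.31) p.259 with (0.20) p.256 and p.298] -/
theorem derivedSource_abs_le {B : (ℕ → ℝ) → ℝ} {G : (ℕ → ℝ) → ℕ → ℝ} {H : (ℕ → ℝ) → ℕ → ℕ → ℝ} {Cm CH θ γ bs ta gs e' : ℝ} {t W σ : ℕ → ℝ}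
    (hB : MemoryProfile Cm θ γ B) (hCm : 0 ≤ Cm) (hθ0 : 0 ≤ θ) (hθ1 : θ < 1) (hbs : 0 < bs) (hta : 0 < ta)
    (hts : SeqBox γ t) (htf : MemFlow B gs t) (hprof : ∀ m : ℕ, 1 / ta ^ 2 + bs * (m : ℝ) ≤ 1 / (t m) ^ 2)
    (hG : ∀ u : ℕ → ℝ, SeqBox γ u → ∀ j, |G u j| ≤ Cm * θ ^ j) (hCH : 0 ≤ CH)
    (hH : ∀ u : ℕ → ℝ, SeqBox γ u → ∀ j i, |H u j i| ≤ CH * θ ^ j * θ ^ i)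
    (h2e' : 2 * e' ≤ γ) (hs1 : 4 * Cm * e' ≤ bs * (1 - θ))
    (hs2 : e' ^ 2 * (1 / gs ^ 2 + Cm * γ / (1 - θ) ^ 2 + (2 * Cm / ((1 - θ) * bs)) ^ 2) ≤ 3 / 4)
    (hs4 : 64 * Cm * e' ^ 3 ≤ (1 - θ) ^ 2) (hs5 : Cm * (8 * e' ^ 3 + 16 * e' / bs) ≤ (1 - θ) / 4) {e : ℝ} (he : e ∈ Ioc (0 : ℝ) e')
    (hW : ∀ k, W k = 1 - ∑ p ∈ range k, ∑' j, G (fun i => solution B e (p + 1 + i)) j * ((solution B e (p + 1 + j)) ^ 3 / 2) * W (p + 1 + j))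
    (hWM : ∀ k, |W k| ≤ 2)
    (hσ : ∀ k, σ k = -∑ p ∈ range k, ∑' j,
      ((-∑' i, H (fun l => solution B e (p + 1 + l)) j i * ((solution B e (p + 1 + i)) ^ 3 / 2 * W (p + 1 + i))) * ((solution B e (p + 1 + j)) ^ 3 / 2)
        + G (fun i => solution B e (p + 1 + i)) j * (-(3 / 4 * (solution B e (p + 1 + j)) ^ 5 * W (p + 1 + j)))) * W (p + 1 + j)) (k : ℕ) :
    |σ k| ≤ (8 * CH * e' ^ 3 / (1 - θ) + 12 * Cm * e' ^ 2) * (8 * e' ^ 3 + 16 * e' / bs) / (1 - θ) := by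
  have he' : 0 < e' := he.1.trans_le he.2
  have h1θ : 0 < 1 - θ := by linarith
  have hK : 0 ≤ 8 * CH * e' ^ 3 / (1 - θ) + 12 * Cm * e' ^ 2 := by positivity
  have hk := kernel_abs_le hθ0 hθ1 (profWeight_nonneg hbs he') (fun hab => profWeight_anti hbs he' hab) (sum_profWeight_le hbs he') zero_le_one hK
    (derivedTerm_abs_le hB hCm hθ0 hθ1 hbs hta hts htf hprof hG hCH hH h2e' hs1 hs2 hs4 hs5 he hW hWM) k
  rw [hσ k, abs_neg]
  simpa only [mul_one] using hk

/-- **THE DERIVED SOURCE CONVERGES IN THE ULTRAVIOLET, AT THE AF RATE**: there is `σ_∞` with `σ_k → σ_∞` and **`|σ_∞ − σ_n| ≤ (K∕(1−θ))·(8∕β*)·(1∕(4e′²) + (β*∕4)n)^{−1∕2}`**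
(part 66's kernel between two scales + part 67's telescoping weight tail). [cite: Balaban1987RG1, Thm 2 (0.31) p.259 with (0.20) p.256 and p.298] -/
theorem derivedSource_limit_exists {B : (ℕ → ℝ) → ℝ} {G : (ℕ → ℝ) → ℕ → ℝ} {H : (ℕ → ℝ) → ℕ → ℕ → ℝ} {Cm CH θ γ bs ta gs e' : ℝ} {t W σ : ℕ → ℝ}
    (hB : MemoryProfile Cm θ γ B) (hCm : 0 ≤ Cm) (hθ0 : 0 ≤ θ) (hθ1 : θ < 1) (hbs : 0 < bs) (hta : 0 < ta)
    (hts : SeqBox γ t) (htf : MemFlow B gs t) (hprof : ∀ m : ℕ, 1 / ta ^ 2 + bs * (m : ℝ) ≤ 1 / (t m) ^ 2)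
    (hG : ∀ u : ℕ → ℝ, SeqBox γ u → ∀ j, |G u j| ≤ Cm * θ ^ j) (hCH : 0 ≤ CH)
    (hH : ∀ u : ℕ → ℝ, SeqBox γ u → ∀ j i, |H u j i| ≤ CH * θ ^ j * θ ^ i)
    (h2e' : 2 * e' ≤ γ) (hs1 : 4 * Cm * e' ≤ bs * (1 - θ))
    (hs2 : e' ^ 2 * (1 / gs ^ 2 + Cm * γ / (1 - θ) ^ 2 + (2 * Cm / ((1 - θ) * bs)) ^ 2) ≤ 3 / 4)
    (hs4 : 64 * Cm * e' ^ 3 ≤ (1 - θ) ^ 2) (hs5 : Cm * (8 * e' ^ 3 + 16 * e' / bs) ≤ (1 - θ) / 4) {e : ℝ} (he : e ∈ Ioc (0 : ℝ) e')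
    (hW : ∀ k, W k = 1 - ∑ p ∈ range k, ∑' j, G (fun i => solution B e (p + 1 + i)) j * ((solution B e (p + 1 + j)) ^ 3 / 2) * W (p + 1 + j))
    (hWM : ∀ k, |W k| ≤ 2)
    (hσ : ∀ k, σ k = -∑ p ∈ range k, ∑' j,
      ((-∑' i, H (fun l => solution B e (p + 1 + l)) j i * ((solution B e (p + 1 + i)) ^ 3 / 2 * W (p + 1 + i))) * ((solution B e (p + 1 + j)) ^ 3 / 2)
        + G (fun i => solution B e (p + 1 + i)) j * (-(3 / 4 * (solution B e (p + 1 + j)) ^ 5 * W (p + 1 + j)))) * W (p + 1 + j)) :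
    ∃ σinf : ℝ, Tendsto σ atTop (𝓝 σinf) ∧
      ∀ n : ℕ, |σinf - σ n| ≤ (8 * CH * e' ^ 3 / (1 - θ) + 12 * Cm * e' ^ 2) * 1 / (1 - θ) * (8 / bs * (1 / sprof (2 * e') (bs / 4) n)) := by
  have he' : 0 < e' := he.1.trans_le he.2
  have h1θ : 0 < 1 - θ := by linarith
  have hK : 0 ≤ 8 * CH * e' ^ 3 / (1 - θ) + 12 * Cm * e' ^ 2 := by positivity
  have hF := derivedTerm_abs_le hB hCm hθ0 hθ1 hbs hta hts htf hprof hG hCH hH h2e' hs1 hs2 hs4 hs5 he hW hWM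
  have hcau : ∀ n k : ℕ, n ≤ k → |σ k - σ n| ≤ (8 * CH * e' ^ 3 / (1 - θ) + 12 * Cm * e' ^ 2) * 1 / (1 - θ) * (8 / bs * (1 / sprof (2 * e') (bs / 4) n)) := by
    intro n k hnk
    have htail := kernel_tail_abs_le hθ0 hθ1 (fun hab => profWeight_anti hbs he' hab) zero_le_one hK hF n k
    have hIco := sum_Ico_profWeight_le hbs he' n k
    have hsplit : σ k - σ n = -∑ p ∈ Ico n k, ∑' j,
        ((-∑' i, H (fun l => solution B e (p + 1 + l)) j i * ((solution B e (p + 1 + i)) ^ 3 / 2 * W (p + 1 + i))) * ((solution B e (p + 1 + j)) ^ 3 / 2)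
          + G (fun i => solution B e (p + 1 + i)) j * (-(3 / 4 * (solution B e (p + 1 + j)) ^ 5 * W (p + 1 + j)))) * W (p + 1 + j) := by
      rw [hσ k, hσ n, ← Finset.sum_range_add_sum_Ico _ hnk]; ring
    rw [hsplit, abs_neg]
    exact htail.trans (mul_le_mul_of_nonneg_left hIco (by positivity))
  have hτ : Tendsto (fun n : ℕ => (8 * CH * e' ^ 3 / (1 - θ) + 12 * Cm * e' ^ 2) * 1 / (1 - θ) * (8 / bs * (1 / sprof (2 * e') (bs / 4) n))) atTop (𝓝 0) := by
    have h := (inv_sprof_tendsto_zero (γ := 2 * e') (by positivity : (0:ℝ) < bs / 4)).const_mul (8 / bs)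
    have h2 := h.const_mul ((8 * CH * e' ^ 3 / (1 - θ) + 12 * Cm * e' ^ 2) * 1 / (1 - θ))
    simpa only [mul_zero] using h2
  exact exists_limit_of_tail hcau hτ

/-! ## §138 The derived linear memory equation: a bounded solution exists, is unique, and has an ultraviolet limit -/

/-- **THE SECOND TANGENT FLOW EXISTS.**  Part 14's package at e′, `hG`, the Hessian profile `hH`, `e ∈ ]0, e′]`, W the tangent flow at e, σ its derived source (`hσ`).  THEN there is
V with **`V_k = σ_k − Σ_{p<k}Σ_j G(h_{p+1+·}) j·(h_{p+1+j}³∕2)·V_{p+1+j}`** for every k and **`|V_k| ≤ 2KS∕(1−θ)`** — part 66's `fixedPoint_exists` with the SAME kernel as the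
tangent flow and the bounded source σ (`derivedSource_abs_le`; smallness = part 14's `hs5`). [cite: Balaban1987RG1, Thm 2 (0.31) p.259 with (0.20) p.256 and p.298] -/
theorem secondTangent_exists {B : (ℕ → ℝ) → ℝ} {G : (ℕ → ℝ) → ℕ → ℝ} {H : (ℕ → ℝ) → ℕ → ℕ → ℝ} {Cm CH θ γ bs ta gs e' : ℝ} {t W σ : ℕ → ℝ}
    (hB : MemoryProfile Cm θ γ B) (hCm : 0 ≤ Cm) (hθ0 : 0 ≤ θ) (hθ1 : θ < 1) (hbs : 0 < bs) (hta : 0 < ta)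
    (hts : SeqBox γ t) (htf : MemFlow B gs t) (hprof : ∀ m : ℕ, 1 / ta ^ 2 + bs * (m : ℝ) ≤ 1 / (t m) ^ 2)
    (hG : ∀ u : ℕ → ℝ, SeqBox γ u → ∀ j, |G u j| ≤ Cm * θ ^ j) (hCH : 0 ≤ CH)
    (hH : ∀ u : ℕ → ℝ, SeqBox γ u → ∀ j i, |H u j i| ≤ CH * θ ^ j * θ ^ i)
    (h2e' : 2 * e' ≤ γ) (hs1 : 4 * Cm * e' ≤ bs * (1 - θ))
    (hs2 : e' ^ 2 * (1 / gs ^ 2 + Cm * γ / (1 - θ) ^ 2 + (2 * Cm / ((1 - θ) * bs)) ^ 2) ≤ 3 / 4)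
    (hs4 : 64 * Cm * e' ^ 3 ≤ (1 - θ) ^ 2) (hs5 : Cm * (8 * e' ^ 3 + 16 * e' / bs) ≤ (1 - θ) / 4) {e : ℝ} (he : e ∈ Ioc (0 : ℝ) e')
    (hW : ∀ k, W k = 1 - ∑ p ∈ range k, ∑' j, G (fun i => solution B e (p + 1 + i)) j * ((solution B e (p + 1 + j)) ^ 3 / 2) * W (p + 1 + j))
    (hWM : ∀ k, |W k| ≤ 2)
    (hσ : ∀ k, σ k = -∑ p ∈ range k, ∑' j,
      ((-∑' i, H (fun l => solution B e (p + 1 + l)) j i * ((solution B e (p + 1 + i)) ^ 3 / 2 * W (p + 1 + i))) * ((solution B e (p + 1 + j)) ^ 3 / 2)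
        + G (fun i => solution B e (p + 1 + i)) j * (-(3 / 4 * (solution B e (p + 1 + j)) ^ 5 * W (p + 1 + j)))) * W (p + 1 + j)) :
    ∃ V : ℕ → ℝ, (∀ k, V k = σ k - ∑ p ∈ range k, ∑' j, G (fun i => solution B e (p + 1 + i)) j * ((solution B e (p + 1 + j)) ^ 3 / 2) * V (p + 1 + j)) ∧
      ∀ k, |V k| ≤ 2 * ((8 * CH * e' ^ 3 / (1 - θ) + 12 * Cm * e' ^ 2) * (8 * e' ^ 3 + 16 * e' / bs) / (1 - θ)) := by
  have he' : 0 < e' := he.1.trans_le he.2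
  obtain ⟨hsb, -, -, -, -, hcube⟩ := solution_facts hB hCm hθ0 hθ1 hbs hta hts htf hprof h2e' hs1 hs2 hs4 hs5 he
  obtain ⟨hc, hv⟩ := tangent_data (B := B) (e' := e') hG hsb hcube
  obtain ⟨-, hq, -⟩ := smallness_of_hs5 (Cm := Cm) (bs := bs) (e' := e') hθ1 hs5
  have hs := derivedSource_abs_le hB hCm hθ0 hθ1 hbs hta hts htf hprof hG hCH hH h2e' hs1 hs2 hs4 hs5 he hW hWM hσ
  exact fixedPoint_exists (s := σ) hCm hθ0 hθ1 (profWeight_nonneg hbs he') (fun hab => profWeight_anti hbs he' hab) (sum_profWeight_le hbs he') hc hv hs hq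

/-- **THE SECOND TANGENT FLOW IS UNIQUE** among bounded sequences (part 66's `fixedPoint_unique`; the source is arbitrary). [folklore] -/
theorem secondTangent_unique {B : (ℕ → ℝ) → ℝ} {G : (ℕ → ℝ) → ℕ → ℝ} {Cm θ γ bs ta gs e' M M' : ℝ} {t σ V V' : ℕ → ℝ}
    (hB : MemoryProfile Cm θ γ B) (hCm : 0 ≤ Cm) (hθ0 : 0 ≤ θ) (hθ1 : θ < 1) (hbs : 0 < bs) (hta : 0 < ta)
    (hts : SeqBox γ t) (htf : MemFlow B gs t) (hprof : ∀ m : ℕ, 1 / ta ^ 2 + bs * (m : ℝ) ≤ 1 / (t m) ^ 2)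
    (hG : ∀ u : ℕ → ℝ, SeqBox γ u → ∀ j, |G u j| ≤ Cm * θ ^ j)
    (h2e' : 2 * e' ≤ γ) (hs1 : 4 * Cm * e' ≤ bs * (1 - θ))
    (hs2 : e' ^ 2 * (1 / gs ^ 2 + Cm * γ / (1 - θ) ^ 2 + (2 * Cm / ((1 - θ) * bs)) ^ 2) ≤ 3 / 4)
    (hs4 : 64 * Cm * e' ^ 3 ≤ (1 - θ) ^ 2) (hs5 : Cm * (8 * e' ^ 3 + 16 * e' / bs) ≤ (1 - θ) / 4) {e : ℝ} (he : e ∈ Ioc (0 : ℝ) e')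
    (hV : ∀ k, V k = σ k - ∑ p ∈ range k, ∑' j, G (fun i => solution B e (p + 1 + i)) j * ((solution B e (p + 1 + j)) ^ 3 / 2) * V (p + 1 + j))
    (hVM : ∀ k, |V k| ≤ M)
    (hV' : ∀ k, V' k = σ k - ∑ p ∈ range k, ∑' j, G (fun i => solution B e (p + 1 + i)) j * ((solution B e (p + 1 + j)) ^ 3 / 2) * V' (p + 1 + j))
    (hVM' : ∀ k, |V' k| ≤ M') : V = V' := by
  have he' : 0 < e' := he.1.trans_le he.2
  obtain ⟨hsb, -, -, -, -, hcube⟩ := solution_facts hB hCm hθ0 hθ1 hbs hta hts htf hprof h2e' hs1 hs2 hs4 hs5 he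
  obtain ⟨hc, hv⟩ := tangent_data (B := B) (e' := e') hG hsb hcube
  obtain ⟨-, hq, -⟩ := smallness_of_hs5 (Cm := Cm) (bs := bs) (e' := e') hθ1 hs5
  exact fixedPoint_unique hCm hθ0 hθ1 (profWeight_nonneg hbs he') (fun hab => profWeight_anti hbs he' hab) (sum_profWeight_le hbs he') hq hc hv hV hVM hV' hVM'

/-- **THE SECOND TANGENT FLOW HAS AN ULTRAVIOLET LIMIT**: for any bounded solution V (by M) of the derived equation with source σ → σ_∞ (`derivedSource_limit_exists`) there is
`V_∞ = lim_k V_k` with **`|(V_∞ − V_n) − (σ_∞ − σ_n)| ≤ (C_m(M∕2)∕(1−θ))·(8∕β*)·(1∕(4e′²) + (β*∕4)n)^{−1∕2}`** (part 67's `fixedPoint_limit_exists`): the AF rate, uniform in the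
pin. [cite: Balaban1987RG1, Thm 2 (0.31) p.259 with (0.20) p.256 and p.298] -/
theorem secondTangentLimit_exists {B : (ℕ → ℝ) → ℝ} {G : (ℕ → ℝ) → ℕ → ℝ} {Cm θ γ bs ta gs e' M σinf : ℝ} {t σ V : ℕ → ℝ}
    (hB : MemoryProfile Cm θ γ B) (hCm : 0 ≤ Cm) (hθ0 : 0 ≤ θ) (hθ1 : θ < 1) (hbs : 0 < bs) (hta : 0 < ta)
    (hts : SeqBox γ t) (htf : MemFlow B gs t) (hprof : ∀ m : ℕ, 1 / ta ^ 2 + bs * (m : ℝ) ≤ 1 / (t m) ^ 2)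
    (hG : ∀ u : ℕ → ℝ, SeqBox γ u → ∀ j, |G u j| ≤ Cm * θ ^ j)
    (h2e' : 2 * e' ≤ γ) (hs1 : 4 * Cm * e' ≤ bs * (1 - θ))
    (hs2 : e' ^ 2 * (1 / gs ^ 2 + Cm * γ / (1 - θ) ^ 2 + (2 * Cm / ((1 - θ) * bs)) ^ 2) ≤ 3 / 4)
    (hs4 : 64 * Cm * e' ^ 3 ≤ (1 - θ) ^ 2) (hs5 : Cm * (8 * e' ^ 3 + 16 * e' / bs) ≤ (1 - θ) / 4) {e : ℝ} (he : e ∈ Ioc (0 : ℝ) e')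
    (hV : ∀ k, V k = σ k - ∑ p ∈ range k, ∑' j, G (fun i => solution B e (p + 1 + i)) j * ((solution B e (p + 1 + j)) ^ 3 / 2) * V (p + 1 + j))
    (hVM : ∀ k, |V k| ≤ M) (hσ : Tendsto σ atTop (𝓝 σinf)) :
    ∃ Vinf : ℝ, Tendsto V atTop (𝓝 Vinf) ∧
      ∀ n : ℕ, |(Vinf - V n) - (σinf - σ n)| ≤ Cm * (M / 2) / (1 - θ) * (8 / bs * (1 / sprof (2 * e') (bs / 4) n)) := by
  have he' : 0 < e' := he.1.trans_le he.2
  obtain ⟨hsb, -, -, -, -, hcube⟩ := solution_facts hB hCm hθ0 hθ1 hbs hta hts htf hprof h2e' hs1 hs2 hs4 hs5 he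
  obtain ⟨hc, hv⟩ := tangent_data (B := B) (e' := e') hG hsb hcube
  have hτ : Tendsto (fun n : ℕ => 8 / bs * (1 / sprof (2 * e') (bs / 4) n)) atTop (𝓝 0) := by
    have h := (inv_sprof_tendsto_zero (γ := 2 * e') (by positivity : (0:ℝ) < bs / 4)).const_mul (8 / bs)
    simpa only [mul_zero] using h
  exact fixedPoint_limit_exists hCm hθ0 hθ1 (fun hab => profWeight_anti hbs he' hab) hc hv hV hVM
    (fun n k _ => sum_Ico_profWeight_le hbs he' n k) hτ hσ

end

end Summit.QuantumFields.BalabanUV.Beta.EriceFlowEnclosureB12AsPrintedHistoryContagionShiftFlowZeroTangentSecond
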